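/-
Copyright (c) 2026. All rights reserved.
Released under Apache 2.0 license as described in the file LICENSE.
-/
import Mathlib.Analysis.SpecialFunctions.ImproperIntegrals
import Mathlib.MeasureTheory.Integral.ExpDecay
import Mathlib.MeasureTheory.Measure.Lebesgue.Integral
import Mathlib.Analysis.SpecialFunctions.Trigonometric.Basic
import Mathlib.Analysis.SpecialFunctions.Pow.Real
import Mathlib.Analysis.Complex.ExponentialBounds
import Mathlib.Analysis.Real.Pi.Bounds

/-!
# Narrow-kernel no-go, line `Sketch`: arithmetic of the block lower bound

Mathlib-only bookkeeping for the block lower bound of the clean narrow energy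
(`UniversalFactor.narrowClean_block`): the error budget `≤ A s⁵` in the scale `s = T^{1/8}`, the
algebra of the resonant test coefficients `c_n = conj(q_n) n^{-1/2} 1_V(n)`, the numerical facts about
the block parameters `N = √(T'/2π)`, `P = ⌊√((T'-s)/2π)⌋`, and the end-game of the duality argument.

Helper file for crux `stmt-RiemannHypothesis-2576` (`UniversalFactor.NarrowKernelNoGo`), stub
`stub_narrowEnergyLowerClean`.
-/

set_option linter.dupNamespace false  -- D-0017 nested layout: `RiemannHypothesis.RiemannHypothesis`

namespace Summit.RiemannHypothesis.RiemannHypothesis.Theorems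

open MeasureTheory Set Filter Complex
open scoped Real Topology ComplexConjugate

/-! ## Arithmetic of the error budget -/

/-- Error bookkeeping, first group (frozen main sum, off-resonant phases, AM–GM term):
`K₀ (3712(P + Σ n‖c_n‖²) + (2/log 2) Σμ^{-1/2} Σ‖c_ν‖ + (s I_e + I_D/s)/2) ≤ A₁ s⁵`. [folklore] -/
theorem UniversalFactor.narrowBlock_arith₁ {K₀ C₂ s Pr SnC Sμ SC1 Ie ID : ℝ}
    (hs : 2 ≤ s) (hK₀ : 0 ≤ K₀) (hC₂ : 0 ≤ C₂) (hPrs : Pr ≤ s ^ 4) (hSnCs : SnC ≤ K₀ ^ 2 * s ^ 4)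
    (hSμ : 0 ≤ Sμ) (hSμs : Sμ ≤ 2 * s ^ 2) (hSC1 : 0 ≤ SC1) (hSC1s : SC1 ≤ 2 * K₀ * s ^ 2)
    (hIes : Ie ≤ 13 * C₂ * s ^ 4) (hIDs : ID ≤ 1859 * K₀ ^ 2 * s ^ 6) :
    K₀ * (3712 * (Pr + SnC) + 2 / Real.log 2 * Sμ * SC1 + (s * Ie + ID / s) / 2) ≤
      K₀ * (3712 * (1 + K₀ ^ 2) + 12 * K₀ + 13 * C₂ + 1859 * K₀ ^ 2) * s ^ 5 := by
  have hs1 : 1 ≤ s := by linarith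
  have hs0 : 0 < s := by linarith
  have hlog2 : 2 / Real.log 2 ≤ 3 := by
    rw [div_le_iff₀ (Real.log_pos one_lt_two)]
    have := Real.log_two_gt_d9
    norm_num at this ⊢
    linarith
  have h45 : s ^ 4 ≤ s ^ 5 := pow_le_pow_right₀ hs1 (by norm_num)
  have h1 : 3712 * (Pr + SnC) ≤ 3712 * (1 + K₀ ^ 2) * s ^ 5 := by
    have := mul_le_mul_of_nonneg_left h45 (sq_nonneg K₀)
    linarith
  have h2 : 2 / Real.log 2 * Sμ * SC1 ≤ 12 * K₀ * s ^ 5 := by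
    have h44 : (0 : ℝ) ≤ 3 * (2 * s ^ 2) := by positivity
    calc 2 / Real.log 2 * Sμ * SC1 ≤ 3 * (2 * s ^ 2) * (2 * K₀ * s ^ 2) :=
          mul_le_mul (mul_le_mul hlog2 hSμs hSμ (by norm_num)) hSC1s hSC1 h44
      _ = 12 * K₀ * s ^ 4 := by ring
      _ ≤ 12 * K₀ * s ^ 5 := mul_le_mul_of_nonneg_left h45 (by positivity)
  have h3 : (s * Ie + ID / s) / 2 ≤ (13 * C₂ + 1859 * K₀ ^ 2) * s ^ 5 := by
    have hIDs' : ID / s ≤ 1859 * K₀ ^ 2 * s ^ 5 := by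
      rw [div_le_iff₀ hs0]
      calc ID ≤ 1859 * K₀ ^ 2 * s ^ 6 := hIDs
        _ = 1859 * K₀ ^ 2 * s ^ 5 * s := by ring
    have hsIe : s * Ie ≤ 13 * C₂ * s ^ 5 := by
      calc s * Ie ≤ s * (13 * C₂ * s ^ 4) := mul_le_mul_of_nonneg_left hIes hs0.le
        _ = 13 * C₂ * s ^ 5 := by ring
    have hn1 : 0 ≤ C₂ * s ^ 5 := mul_nonneg hC₂ (pow_nonneg hs0.le 5)
    have hn2 : 0 ≤ K₀ ^ 2 * s ^ 5 := mul_nonneg (sq_nonneg K₀) (pow_nonneg hs0.le 5)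
    linarith
  calc _ ≤ K₀ * (3712 * (1 + K₀ ^ 2) * s ^ 5 + 12 * K₀ * s ^ 5 + (13 * C₂ + 1859 * K₀ ^ 2) * s ^ 5) :=
        mul_le_mul_of_nonneg_left (add_le_add (add_le_add h1 h2) h3) hK₀
    _ = _ := by ring

/-- Error bookkeeping, second group (linearised phase `× ∫ (U|u| + u²) κ`):
`(U K₁ + K₂)/T' · (I_D + U(1 + log P) + 1856 P)/2 ≤ A₂ s⁵`. [folklore] -/
theorem UniversalFactor.narrowBlock_arith₂ {K₀ K₁ K₂ s U T' Pr ID lP : ℝ}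
    (hs : 2 ≤ s) (hK₁ : 0 ≤ K₁) (hK₂ : 0 ≤ K₂) (hPr : 0 ≤ Pr) (hPrs : Pr ≤ s ^ 4)
    (hID : 0 ≤ ID) (hIDs : ID ≤ 1859 * K₀ ^ 2 * s ^ 6)
    (hU : 0 ≤ U) (hUs : U ≤ s ^ 6) (hT' : s ^ 8 ≤ T') (hlP : 0 ≤ lP) (hlPs : lP ≤ 4 * s) :
    (U * K₁ + K₂) / T' * ((ID + (U * (1 + lP) + 1856 * Pr)) / 2) ≤
      (K₁ + K₂) * (1859 * K₀ ^ 2 + 1861) * s ^ 5 := by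
  have hs1 : 1 ≤ s := by linarith
  have hs0 : 0 < s := by linarith
  have hT'0 : 0 < T' := lt_of_lt_of_le (by positivity) hT'
  have h06 : 1 ≤ s ^ 6 := one_le_pow₀ hs1
  have hq : (U * K₁ + K₂) / T' ≤ (K₁ + K₂) / s ^ 2 := by
    rw [div_le_div_iff₀ hT'0 (by positivity)]
    have ha : U * K₁ ≤ s ^ 6 * K₁ := mul_le_mul_of_nonneg_right hUs hK₁
    have hb : K₂ ≤ s ^ 6 * K₂ := le_mul_of_one_le_left hK₂ h06
    calc (U * K₁ + K₂) * s ^ 2 ≤ (s ^ 6 * K₁ + s ^ 6 * K₂) * s ^ 2 :=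
          mul_le_mul_of_nonneg_right (add_le_add ha hb) (by positivity)
      _ = (K₁ + K₂) * s ^ 8 := by ring
      _ ≤ (K₁ + K₂) * T' := mul_le_mul_of_nonneg_left hT' (by positivity)
  have hr : (ID + (U * (1 + lP) + 1856 * Pr)) / 2 ≤ (1859 * K₀ ^ 2 + 1861) * s ^ 7 := by
    have hUl : U * (1 + lP) ≤ 5 * s ^ 7 := by
      calc U * (1 + lP) ≤ s ^ 6 * (5 * s) := mul_le_mul hUs (by linarith) (by linarith) (by positivity)
        _ = 5 * s ^ 7 := by ring
    have h67 : s ^ 6 ≤ s ^ 7 := pow_le_pow_right₀ hs1 (by norm_num)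
    have h47 : s ^ 4 ≤ s ^ 7 := pow_le_pow_right₀ hs1 (by norm_num)
    have hI7 : ID ≤ 1859 * K₀ ^ 2 * s ^ 7 :=
      hIDs.trans (mul_le_mul_of_nonneg_left h67 (by positivity))
    have hn : 0 ≤ K₀ ^ 2 * s ^ 7 := mul_nonneg (sq_nonneg K₀) (pow_nonneg hs0.le 7)
    have hUl0 : 0 ≤ U * (1 + lP) := mul_nonneg hU (by linarith)
    linarith
  calc _ ≤ (K₁ + K₂) / s ^ 2 * ((1859 * K₀ ^ 2 + 1861) * s ^ 7) :=
        mul_le_mul hq hr (by positivity) (by positivity)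
    _ = (K₁ + K₂) * (1859 * K₀ ^ 2 + 1861) * s ^ 5 := by
        rw [div_mul_eq_mul_div, div_eq_iff (by positivity)]
        ring

/-- Error bookkeeping, third group (kernel tail beyond `|u| > s`):
`Tail · U(3 + 2(T' + U)) Σ‖c_n‖ ≤ 18 K₀ M₁ M' s⁵`. [folklore] -/
theorem UniversalFactor.narrowBlock_arith₃ {K₀ M₁ M' s U T' SC1 Tail E : ℝ}
    (hs : 2 ≤ s) (hK₀ : 0 ≤ K₀) (hM₁ : 0 ≤ M₁) (hSC1 : 0 ≤ SC1) (hSC1s : SC1 ≤ 2 * K₀ * s ^ 2)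
    (hU : 0 ≤ U) (hUs : U ≤ s ^ 6) (hT' : s ^ 8 ≤ T') (hT's : T' ≤ 2 * s ^ 8)
    (hTails : Tail ≤ M₁ * E) (hE : 0 ≤ E) (hEs : s ^ 11 * E ≤ M') :
    Tail * (U * (3 + 2 * (T' + U)) * SC1) ≤ 18 * K₀ * M₁ * M' * s ^ 5 := by
  have hs1 : 1 ≤ s := by linarith
  have hs0 : 0 < s := by linarith
  have hT'0 : 0 < T' := lt_of_lt_of_le (by positivity) hT'
  have h3p : (0 : ℝ) ≤ 3 + 2 * (T' + U) := by linarith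
  have hfac : U * (3 + 2 * (T' + U)) * SC1 ≤ 18 * K₀ * s ^ 16 := by
    have h08 : 1 ≤ s ^ 8 := one_le_pow₀ hs1
    have h68 : s ^ 6 ≤ s ^ 8 := pow_le_pow_right₀ hs1 (by norm_num)
    have hmid : 3 + 2 * (T' + U) ≤ 9 * s ^ 8 := by linarith
    have h6 : (0 : ℝ) ≤ s ^ 6 := pow_nonneg hs0.le 6
    have h98 : (0 : ℝ) ≤ s ^ 6 * (9 * s ^ 8) := mul_nonneg h6 (mul_nonneg (by norm_num) (pow_nonneg hs0.le 8))
    calc U * (3 + 2 * (T' + U)) * SC1 ≤ s ^ 6 * (9 * s ^ 8) * (2 * K₀ * s ^ 2) :=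
          mul_le_mul (mul_le_mul hUs hmid h3p h6) hSC1s hSC1 h98
      _ = 18 * K₀ * s ^ 16 := by ring
  have hUT : 0 ≤ U * (3 + 2 * (T' + U)) * SC1 := mul_nonneg (mul_nonneg hU h3p) hSC1
  have h18 : (0 : ℝ) ≤ 18 * K₀ * M₁ := mul_nonneg (mul_nonneg (by norm_num) hK₀) hM₁
  calc Tail * (U * (3 + 2 * (T' + U)) * SC1) ≤ (M₁ * E) * (18 * K₀ * s ^ 16) :=
        mul_le_mul hTails hfac hUT (mul_nonneg hM₁ hE)
    _ = 18 * K₀ * M₁ * (s ^ 11 * E) * s ^ 5 := by ring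
    _ ≤ 18 * K₀ * M₁ * M' * s ^ 5 :=
        mul_le_mul_of_nonneg_right (mul_le_mul_of_nonneg_left hEs h18) (pow_nonneg hs0.le 5)

/-- Pure bookkeeping: with all sizes measured in `s = T^{1/8}` (`u₀ = η = s`), the error of the
block identity is `≤ A s⁵` for an explicit constant `A = A(K₀, K₁, K₂, C₂, M₁, M')`. [folklore] -/
theorem UniversalFactor.narrowBlock_arith {K₀ K₁ K₂ C₂ M₁ M' s U T' Pr SnC Sμ SC1 Ie ID lP Tail E : ℝ}
    (hs : 2 ≤ s) (hK₀ : 0 ≤ K₀) (hK₁ : 0 ≤ K₁) (hK₂ : 0 ≤ K₂) (hC₂ : 0 ≤ C₂) (hM₁ : 0 ≤ M₁)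
    (hPr : 0 ≤ Pr) (hPrs : Pr ≤ s ^ 4) (hSnCs : SnC ≤ K₀ ^ 2 * s ^ 4)
    (hSμ : 0 ≤ Sμ) (hSμs : Sμ ≤ 2 * s ^ 2) (hSC1 : 0 ≤ SC1) (hSC1s : SC1 ≤ 2 * K₀ * s ^ 2)
    (hIes : Ie ≤ 13 * C₂ * s ^ 4) (hID : 0 ≤ ID) (hIDs : ID ≤ 1859 * K₀ ^ 2 * s ^ 6)
    (hU : 0 ≤ U) (hUs : U ≤ s ^ 6) (hT' : s ^ 8 ≤ T') (hT's : T' ≤ 2 * s ^ 8) (hlP : 0 ≤ lP)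
    (hlPs : lP ≤ 4 * s) (hTails : Tail ≤ M₁ * E) (hE : 0 ≤ E) (hEs : s ^ 11 * E ≤ M') :
    K₀ * (3712 * (Pr + SnC) + 2 / Real.log 2 * Sμ * SC1 + (s * Ie + ID / s) / 2) +
      (U * K₁ + K₂) / T' * ((ID + (U * (1 + lP) + 1856 * Pr)) / 2) +
      Tail * (U * (3 + 2 * (T' + U)) * SC1) ≤
      (K₀ * (3712 * (1 + K₀ ^ 2) + 12 * K₀ + 13 * C₂ + 1859 * K₀ ^ 2) +
        (K₁ + K₂) * (1859 * K₀ ^ 2 + 1861) + 18 * K₀ * M₁ * M') * s ^ 5 := by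
  have h1 := UniversalFactor.narrowBlock_arith₁ hs hK₀ hC₂ hPrs hSnCs hSμ hSμs hSC1 hSC1s hIes hIDs
  have h2 := UniversalFactor.narrowBlock_arith₂ (K₀ := K₀) hs hK₁ hK₂ hPr hPrs hID hIDs hU hUs hT' hlP hlPs
  have h3 := UniversalFactor.narrowBlock_arith₃ hs hK₀ hM₁ hSC1 hSC1s hU hUs hT' hT's hTails hE hEs
  calc _ ≤ K₀ * (3712 * (1 + K₀ ^ 2) + 12 * K₀ + 13 * C₂ + 1859 * K₀ ^ 2) * s ^ 5 +
        (K₁ + K₂) * (1859 * K₀ ^ 2 + 1861) * s ^ 5 + 18 * K₀ * M₁ * M' * s ^ 5 :=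
        add_le_add (add_le_add h1 h2) h3
    _ = _ := by ring

/-! ## The test coefficients `c_n = conj(q_n) n^{-1/2} 1_V(n)` -/

/-- Pointwise algebra of `conj(q) n^{-1/2}`: its norm, `n ‖·‖²`, `‖·‖²` and the diagonal product
`conj(q) n^{-1/2} · n^{-1/2} q = ‖q‖²/n`. [folklore] -/
theorem UniversalFactor.narrowBlockCoeff_pointwise (q : ℂ) {n : ℕ} (hn : 1 ≤ n) :
    ‖conj q * (((n : ℝ) ^ (-(1 / 2 : ℝ)) : ℝ) : ℂ)‖ = ‖q‖ * (n : ℝ) ^ (-(1 / 2 : ℝ)) ∧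
    (n : ℝ) * (‖q‖ * (n : ℝ) ^ (-(1 / 2 : ℝ))) ^ 2 = ‖q‖ ^ 2 ∧
    (‖q‖ * (n : ℝ) ^ (-(1 / 2 : ℝ))) ^ 2 = ‖q‖ ^ 2 / n ∧
    conj q * (((n : ℝ) ^ (-(1 / 2 : ℝ)) : ℝ) : ℂ) * (((n : ℝ) ^ (-(1 / 2 : ℝ)) : ℝ) : ℂ) * q = ((‖q‖ ^ 2 / n : ℝ) : ℂ) := by
  have hn0 : (0 : ℝ) < n := by exact_mod_cast hn
  have hr0 : 0 < (n : ℝ) ^ (-(1 / 2 : ℝ)) := Real.rpow_pos_of_pos hn0 _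
  have hr2 : ((n : ℝ) ^ (-(1 / 2 : ℝ))) ^ 2 = (n : ℝ)⁻¹ := by
    rw [← Real.rpow_natCast, ← Real.rpow_mul hn0.le, show (-(1 / 2 : ℝ)) * ((2 : ℕ) : ℝ) = -1 by norm_num,
      Real.rpow_neg_one]
  refine ⟨?_, ?_, ?_, ?_⟩
  · rw [norm_mul, Complex.norm_conj, Complex.norm_real, Real.norm_of_nonneg hr0.le]
  · rw [mul_pow, hr2]
    field_simp
  · rw [mul_pow, hr2, div_eq_mul_inv]
  · have h1 : conj q * (((n : ℝ) ^ (-(1 / 2 : ℝ)) : ℝ) : ℂ) * (((n : ℝ) ^ (-(1 / 2 : ℝ)) : ℝ) : ℂ) * q = ((((n : ℝ) ^ (-(1 / 2 : ℝ))) ^ 2 : ℝ) : ℂ) * (conj q * q) := by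
      push_cast
      ring
    rw [h1, hr2, Complex.conj_mul']
    push_cast
    rw [div_eq_inv_mul]

/-- **Sums of the test coefficients.**  With `c_n = conj(q_n) n^{-1/2}` on the window `V` and `0`
elsewhere (`V ⊆ [1, P]`): the diagonal `Σ c_n n^{-1/2} q_n = Σ_V ‖q_n‖²/n`, and the three norms sums
`Σ n‖c_n‖² = Σ_V ‖q_n‖²`, `Σ ‖c_n‖² = Σ_V ‖q_n‖²/n`, `Σ ‖c_n‖ = Σ_V ‖q_n‖ n^{-1/2}`. [folklore] -/
theorem UniversalFactor.narrowBlockCoeff_sums (a L : ℝ) {P : ℕ} (hP : ⌊Real.exp L / Real.exp 1⌋₊ ≤ P)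
    (c : ℕ → ℂ) (hc : ∀ n : ℕ, c n = if n ∈ Finset.Icc (⌊Real.exp L / Real.exp 2⌋₊ + 1) ⌊Real.exp L / Real.exp 1⌋₊ then
      conj (∫ u : ℝ, ((Real.exp (-(2 * a * |u|)) * Real.exp (-(π * u / 4)) : ℝ) : ℂ) * cexp (I * (L - Real.log n) * u)) * (((n : ℝ) ^ (-(1 / 2 : ℝ)) : ℝ) : ℂ) else 0) :
    (∑ n ∈ Finset.Icc 1 P, c n * (((n : ℝ) ^ (-(1 / 2 : ℝ)) : ℝ) : ℂ) * ∫ u : ℝ, ((Real.exp (-(2 * a * |u|)) * Real.exp (-(π * u / 4)) : ℝ) : ℂ) * cexp (I * (L - Real.log n) * u) =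
      ((∑ n ∈ Finset.Icc (⌊Real.exp L / Real.exp 2⌋₊ + 1) ⌊Real.exp L / Real.exp 1⌋₊, ‖∫ u : ℝ, ((Real.exp (-(2 * a * |u|)) * Real.exp (-(π * u / 4)) : ℝ) : ℂ) * cexp (I * (L - Real.log n) * u)‖ ^ 2 / n : ℝ) : ℂ)) ∧
    (∑ n ∈ Finset.Icc 1 P, (n : ℝ) * ‖c n‖ ^ 2 = ∑ n ∈ Finset.Icc (⌊Real.exp L / Real.exp 2⌋₊ + 1) ⌊Real.exp L / Real.exp 1⌋₊, ‖∫ u : ℝ, ((Real.exp (-(2 * a * |u|)) * Real.exp (-(π * u / 4)) : ℝ) : ℂ) * cexp (I * (L - Real.log n) * u)‖ ^ 2) ∧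
    (∑ n ∈ Finset.Icc 1 P, ‖c n‖ ^ 2 = ∑ n ∈ Finset.Icc (⌊Real.exp L / Real.exp 2⌋₊ + 1) ⌊Real.exp L / Real.exp 1⌋₊, ‖∫ u : ℝ, ((Real.exp (-(2 * a * |u|)) * Real.exp (-(π * u / 4)) : ℝ) : ℂ) * cexp (I * (L - Real.log n) * u)‖ ^ 2 / n) ∧
    (∑ n ∈ Finset.Icc 1 P, ‖c n‖ = ∑ n ∈ Finset.Icc (⌊Real.exp L / Real.exp 2⌋₊ + 1) ⌊Real.exp L / Real.exp 1⌋₊, ‖∫ u : ℝ, ((Real.exp (-(2 * a * |u|)) * Real.exp (-(π * u / 4)) : ℝ) : ℂ) * cexp (I * (L - Real.log n) * u)‖ * (n : ℝ) ^ (-(1 / 2 : ℝ))) ∧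
    (∀ n : ℕ, c n ≠ 0 → n ∈ Finset.Icc (⌊Real.exp L / Real.exp 2⌋₊ + 1) ⌊Real.exp L / Real.exp 1⌋₊) := by
  have hsub : Finset.Icc (⌊Real.exp L / Real.exp 2⌋₊ + 1) ⌊Real.exp L / Real.exp 1⌋₊ ⊆ Finset.Icc 1 P := by
    intro n hn
    rw [Finset.mem_Icc] at hn ⊢
    exact ⟨by omega, hn.2.trans hP⟩
  have hinter : Finset.Icc 1 P ∩ Finset.Icc (⌊Real.exp L / Real.exp 2⌋₊ + 1) ⌊Real.exp L / Real.exp 1⌋₊ = Finset.Icc (⌊Real.exp L / Real.exp 2⌋₊ + 1) ⌊Real.exp L / Real.exp 1⌋₊ := Finset.inter_eq_right.mpr hsub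
  have hone : ∀ n ∈ Finset.Icc (⌊Real.exp L / Real.exp 2⌋₊ + 1) ⌊Real.exp L / Real.exp 1⌋₊, 1 ≤ n := fun n hn => (Finset.mem_Icc.1 (hsub hn)).1
  refine ⟨?_, ?_, ?_, ?_, ?_⟩
  · have key : ∀ n ∈ Finset.Icc 1 P, c n * (((n : ℝ) ^ (-(1 / 2 : ℝ)) : ℝ) : ℂ) * ∫ u : ℝ, ((Real.exp (-(2 * a * |u|)) * Real.exp (-(π * u / 4)) : ℝ) : ℂ) * cexp (I * (L - Real.log n) * u) =
        if n ∈ Finset.Icc (⌊Real.exp L / Real.exp 2⌋₊ + 1) ⌊Real.exp L / Real.exp 1⌋₊ then ((‖∫ u : ℝ, ((Real.exp (-(2 * a * |u|)) * Real.exp (-(π * u / 4)) : ℝ) : ℂ) * cexp (I * (L - Real.log n) * u)‖ ^ 2 / n : ℝ) : ℂ) else 0 := by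
      intro n _
      rw [hc n]
      split_ifs with h
      · exact (UniversalFactor.narrowBlockCoeff_pointwise _ (hone n h)).2.2.2
      · simp
    rw [Finset.sum_congr rfl key, Finset.sum_ite_mem, hinter, Complex.ofReal_sum]
  · have key : ∀ n ∈ Finset.Icc 1 P, (n : ℝ) * ‖c n‖ ^ 2 = if n ∈ Finset.Icc (⌊Real.exp L / Real.exp 2⌋₊ + 1) ⌊Real.exp L / Real.exp 1⌋₊ then ‖∫ u : ℝ, ((Real.exp (-(2 * a * |u|)) * Real.exp (-(π * u / 4)) : ℝ) : ℂ) * cexp (I * (L - Real.log n) * u)‖ ^ 2 else 0 := by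
      intro n _
      rw [hc n]
      split_ifs with h
      · rw [(UniversalFactor.narrowBlockCoeff_pointwise _ (hone n h)).1]
        exact (UniversalFactor.narrowBlockCoeff_pointwise _ (hone n h)).2.1
      · simp
    rw [Finset.sum_congr rfl key, Finset.sum_ite_mem, hinter]
  · have key : ∀ n ∈ Finset.Icc 1 P, ‖c n‖ ^ 2 = if n ∈ Finset.Icc (⌊Real.exp L / Real.exp 2⌋₊ + 1) ⌊Real.exp L / Real.exp 1⌋₊ then ‖∫ u : ℝ, ((Real.exp (-(2 * a * |u|)) * Real.exp (-(π * u / 4)) : ℝ) : ℂ) * cexp (I * (L - Real.log n) * u)‖ ^ 2 / n else 0 := by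
      intro n _
      rw [hc n]
      split_ifs with h
      · rw [(UniversalFactor.narrowBlockCoeff_pointwise _ (hone n h)).1]
        exact (UniversalFactor.narrowBlockCoeff_pointwise _ (hone n h)).2.2.1
      · simp
    rw [Finset.sum_congr rfl key, Finset.sum_ite_mem, hinter]
  · have key : ∀ n ∈ Finset.Icc 1 P, ‖c n‖ = if n ∈ Finset.Icc (⌊Real.exp L / Real.exp 2⌋₊ + 1) ⌊Real.exp L / Real.exp 1⌋₊ then ‖∫ u : ℝ, ((Real.exp (-(2 * a * |u|)) * Real.exp (-(π * u / 4)) : ℝ) : ℂ) * cexp (I * (L - Real.log n) * u)‖ * (n : ℝ) ^ (-(1 / 2 : ℝ)) else 0 := by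
      intro n _
      rw [hc n]
      split_ifs with h
      · exact (UniversalFactor.narrowBlockCoeff_pointwise _ (hone n h)).1
      · simp
    rw [Finset.sum_congr rfl key, Finset.sum_ite_mem, hinter]
  · intro n hn
    by_contra hV
    exact hn (by rw [hc n, if_neg hV])

/-! ## The block lower bound: parameters, coefficient bounds, error bound, end-game -/

/-- Numerical facts about `e`: `4 ≤ e²`, written for `Real.exp 1 ^ 2` and `Real.exp 2`. [folklore] -/
theorem UniversalFactor.narrow_four_le_exp_sq : 4 ≤ Real.exp 1 ^ 2 ∧ Real.exp 1 ^ 2 = Real.exp 2 := by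
  have h1 : (2 : ℝ) ≤ Real.exp 1 := by
    have := Real.add_one_le_exp (1 : ℝ)
    linarith
  refine ⟨by nlinarith, ?_⟩
  rw [sq, ← Real.exp_add]
  norm_num

/-- **Parameters of a block.**  With `s ≥ 4`, `s⁸ ≤ T' ≤ 2s⁸`, `L = log(T'/2π)/2`, `N = e^L`,
`P = ⌊√((T'-s)/2π)⌋`: `42 ≤ N ≤ s⁴`, `N² = T'/2π`, `P ≤ s⁴`, `2πP² ≤ T' - s`, `⌊N/e⌋ ≤ P`,
`8πν² ≤ T'` for `ν ≤ N/e`, and `0 ≤ log P ≤ 4s`. [folklore] -/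
theorem UniversalFactor.narrowClean_params {s T' : ℝ} (hs4 : 4 ≤ s) (hT'1 : s ^ 8 ≤ T')
    (hT'2 : T' ≤ 2 * s ^ 8) :
    0 < T' ∧ s ≤ T' / 2 ∧ s ^ 8 / 2 ≤ T' - s ∧
    42 ≤ Real.exp (Real.log (T' / (2 * π)) / 2) ∧
    Real.exp (Real.log (T' / (2 * π)) / 2) ≤ s ^ 4 ∧
    Real.exp (Real.log (T' / (2 * π)) / 2) ^ 2 = T' / (2 * π) ∧
    (⌊Real.sqrt ((T' - s) / (2 * π))⌋₊ : ℝ) ≤ s ^ 4 ∧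
    2 * π * (⌊Real.sqrt ((T' - s) / (2 * π))⌋₊ : ℝ) ^ 2 ≤ T' - s ∧
    ⌊Real.exp (Real.log (T' / (2 * π)) / 2) / Real.exp 1⌋₊ ≤ ⌊Real.sqrt ((T' - s) / (2 * π))⌋₊ ∧
    (∀ ν : ℕ, (ν : ℝ) ≤ Real.exp (Real.log (T' / (2 * π)) / 2) / Real.exp 1 →
      8 * π * (ν : ℝ) ^ 2 ≤ T') ∧
    0 ≤ Real.log (⌊Real.sqrt ((T' - s) / (2 * π))⌋₊ : ℝ) ∧
    Real.log (⌊Real.sqrt ((T' - s) / (2 * π))⌋₊ : ℝ) ≤ 4 * s := by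
  have hs2 : 2 ≤ s := by linarith
  have hs1 : 1 ≤ s := by linarith
  have hs0 : 0 < s := by linarith
  have hs8pos : 0 < s ^ 8 := by positivity
  have hT'0 : 0 < T' := lt_of_lt_of_le hs8pos hT'1
  have hπ3 := Real.pi_gt_three
  have hπ4 := Real.pi_le_four
  have hs7 : (2 : ℝ) ^ 7 ≤ s ^ 7 := pow_le_pow_left₀ (by norm_num) hs2 7
  have hss8 : 4 * s ≤ s ^ 8 := by
    calc 4 * s ≤ 2 ^ 7 * s := by linarith
      _ ≤ s ^ 7 * s := mul_le_mul_of_nonneg_right hs7 hs0.le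
      _ = s ^ 8 := by ring
  have hsT' : s ≤ T' / 2 := by linarith
  have hT₀ : s ^ 8 / 2 ≤ T' - s := by linarith
  have hT₀pos : 0 < T' - s := by linarith
  set N : ℝ := Real.exp (Real.log (T' / (2 * π)) / 2) with hN
  have hNpos : 0 < N := Real.exp_pos _
  have hN2 : N ^ 2 = T' / (2 * π) := by
    rw [hN, sq, ← Real.exp_add, add_halves, Real.exp_log (by positivity)]
  have hN42 : 42 ≤ N := by
    have h48 : (4 : ℝ) ^ 8 ≤ s ^ 8 := pow_le_pow_left₀ (by norm_num) hs4 8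
    have h2 : (42 : ℝ) ^ 2 ≤ N ^ 2 := by
      rw [hN2, le_div_iff₀ (by positivity)]
      norm_num at h48 ⊢
      linarith
    exact le_of_pow_le_pow_left₀ two_ne_zero hNpos.le h2
  have hNs4 : N ≤ s ^ 4 := by
    have h2 : N ^ 2 ≤ (s ^ 4) ^ 2 := by
      rw [hN2, div_le_iff₀ (by positivity), show (s ^ 4) ^ 2 = s ^ 8 by ring]
      have : s ^ 8 ≤ s ^ 8 * π := le_mul_of_one_le_right hs8pos.le (by linarith)
      linarith
    exact le_of_pow_le_pow_left₀ two_ne_zero (by positivity) h2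
  have hsqrtN : Real.sqrt (T' / (2 * π)) = N := by rw [← hN2, Real.sqrt_sq hNpos.le]
  obtain ⟨he4, -⟩ := UniversalFactor.narrow_four_le_exp_sq
  set P : ℕ := ⌊Real.sqrt ((T' - s) / (2 * π))⌋₊ with hP
  have hρ0 : 0 ≤ Real.sqrt ((T' - s) / (2 * π)) := Real.sqrt_nonneg _
  have hPρ : (P : ℝ) ≤ Real.sqrt ((T' - s) / (2 * π)) := Nat.floor_le hρ0
  have hPN : (P : ℝ) ≤ N :=
    hPρ.trans (hsqrtN ▸ Real.sqrt_le_sqrt (div_le_div_of_nonneg_right (by linarith) (by positivity)))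
  have hPs4 : (P : ℝ) ≤ s ^ 4 := hPN.trans hNs4
  have hP2 : 2 * π * (P : ℝ) ^ 2 ≤ T' - s := by
    have h1 : (P : ℝ) ^ 2 ≤ Real.sqrt ((T' - s) / (2 * π)) ^ 2 := pow_le_pow_left₀ (Nat.cast_nonneg P) hPρ 2
    rw [Real.sq_sqrt (div_nonneg hT₀pos.le (by positivity)), le_div_iff₀ (by positivity)] at h1
    linarith
  have hfloorP : ⌊N / Real.exp 1⌋₊ ≤ P := by
    refine Nat.floor_mono ((Real.le_sqrt (by positivity) (div_nonneg hT₀pos.le (by positivity))).2 ?_)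
    rw [div_pow, hN2, div_div, div_le_div_iff₀ (by positivity) (by positivity)]
    calc T' * (2 * π) ≤ 2 * (T' - s) * (2 * π) := mul_le_mul_of_nonneg_right (by linarith) (by positivity)
      _ = (T' - s) * (2 * π * 2) := by ring
      _ ≤ (T' - s) * (2 * π * Real.exp 1 ^ 2) :=
          mul_le_mul_of_nonneg_left (mul_le_mul_of_nonneg_left (by linarith) (by positivity)) hT₀pos.le
  have hνT : ∀ ν : ℕ, (ν : ℝ) ≤ N / Real.exp 1 → 8 * π * (ν : ℝ) ^ 2 ≤ T' := by
    intro ν h3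
    have h4 : (ν : ℝ) ^ 2 ≤ (N / Real.exp 1) ^ 2 := pow_le_pow_left₀ (Nat.cast_nonneg ν) h3 2
    rw [div_pow, hN2, div_div, le_div_iff₀ (by positivity)] at h4
    calc 8 * π * (ν : ℝ) ^ 2 = (ν : ℝ) ^ 2 * (2 * π * 4) := by ring
      _ ≤ (ν : ℝ) ^ 2 * (2 * π * Real.exp 1 ^ 2) :=
          mul_le_mul_of_nonneg_left (mul_le_mul_of_nonneg_left he4 (by positivity)) (sq_nonneg _)
      _ ≤ T' := h4
  have hlP0 : 0 ≤ Real.log P := Real.log_natCast_nonneg P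
  have hlPs : Real.log P ≤ 4 * s := by
    rcases Nat.eq_zero_or_pos P with hP0 | hP0
    · rw [hP0, Nat.cast_zero, Real.log_zero]
      linarith
    · have h1 : Real.log P ≤ Real.log (s ^ 4) := Real.log_le_log (by exact_mod_cast hP0) hPs4
      rw [Real.log_pow, Nat.cast_ofNat] at h1
      have h2 := Real.log_le_sub_one_of_pos hs0
      linarith
  exact ⟨hT'0, hsT', hT₀, hN42, hNs4, hN2, hPs4, hP2, hfloorP, hνT, hlP0, hlPs⟩

/-- **End-game of the duality argument**: from `‖∫ gX‖ ≥ U Σ/2`, `‖∫ gX‖² ≤ (∫ g²)(∫ ‖X‖²)`,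
`∫ ‖X‖² ≤ 2 U Σ` and `Σ ≥ m²/2` conclude `∫ g² ≥ (m²/32) U`. [folklore] -/
theorem UniversalFactor.narrowClean_endgame {G J ID U SV m s : ℝ} (hG0 : 0 ≤ G) (hU0 : 0 ≤ U)
    (hU1 : s ^ 6 / 2 ≤ U) (hSVge : m ^ 2 / 2 ≤ SV) (hm0 : 0 < m) (hs0 : 0 < s)
    (hJ : U * SV / 2 ≤ J) (hdual : J ^ 2 ≤ G * ID) (hID2 : ID ≤ 2 * (U * SV)) :
    m ^ 2 / 32 * U ≤ G := by
  have hUSV : m ^ 2 * s ^ 6 / 4 ≤ U * SV := by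
    have hm2 : 0 ≤ m ^ 2 / 2 := by positivity
    have := mul_le_mul hU1 hSVge hm2 hU0
    linarith
  have hUSVpos : 0 < U * SV := lt_of_lt_of_le (by positivity) hUSV
  have h1 : (U * SV / 2) ^ 2 ≤ G * (2 * (U * SV)) :=
    (pow_le_pow_left₀ (by positivity) hJ 2).trans (hdual.trans (mul_le_mul_of_nonneg_left hID2 hG0))
  have hG1 : U * SV / 8 ≤ G := by
    by_contra h
    push Not at h
    have h3 := mul_lt_mul_of_pos_right h (by positivity : (0 : ℝ) < 2 * (U * SV))
    nlinarith only [h1, h3]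
  have h2 : m ^ 2 / 32 * U ≤ U * SV / 8 := by
    have := mul_le_mul_of_nonneg_left hSVge hU0
    linarith
  exact h2.trans hG1

/-- Registered sub-stub `narrowBlockArith_exp_sq` of crux `stmt-RiemannHypothesis-2576` (binder-free restatement of
`UniversalFactor.narrow_four_le_exp_sq`, used by the gate to attach this helper file to the crux). [folklore] -/
theorem UniversalFactor.narrowBlockArith_exp_sq : 4 ≤ Real.exp 1 ^ 2 ∧ Real.exp 1 ^ 2 = Real.exp 2 :=
  UniversalFactor.narrow_four_le_exp_sq

end Summit.RiemannHypothesis.RiemannHypothesis.Theorems
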